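import Literature.RingTheory.KTheory.MilnorKSumOfSquares
import Mathlib.Analysis.SpecialFunctions.Pow.Real
import HarnessLib

/-!
# EXAMPLE 1.6: `K_nℝ = ℤ/2·l(−1)ⁿ ⊕ (divisible)` for `n ≥ 1`
# (Milnor, *Algebraic K-theory and quadratic forms*, Invent. Math. 9 (1970), §1)

Family `hodge`, lane `lit-hodgefound` (foundations library; seat `lit-hodgefound-p27`, generation 40, row g40-#5);
topic `RingTheory/KTheory`.  Sequel of `MilnorKSumOfSquares` (g40-#4: the sign homomorphism `signHomK` of a total
preordering, `sgnBit`) and of `MilnorKGroups` / `MilnorKTameSymbol` (symbols, `cons`, `two_smul_cons_neg_one`).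
DEFINITIONS WITH BODIES (`nonnegPreordering`, `signHomOrd`, `absUnit`, `posSymbols`, `posPart`) and PROVED THEOREMS; no
named fact, no instance, no notation, 0 `sorry`, net debt 0 (D-0026).

## The source, verbatim

J. Milnor, *Algebraic K-theory and quadratic forms*, Invent. Math. 9 (1970) 318–344 (held `paper:doi-10-1007-bf01425486`;
bib key `Milnor1970`), §1 (p0004 L13–L17): «**EXAMPLE 1.6.** Let R be the field of real numbers. Then every K_nR,
n ≥ 1, splits as the direct sum of a cyclic group of order 2 generated by l(−1)ⁿ, and a divisible group generated by
all products l(a₁)⋯l(aₙ) with a₁, …, aₙ > 0. This is easily proved by induction on n, using the argument of §1.4 to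
show that l(−1)ⁿ is not divisible.»  (The argument of §1.4, p0003 L25–L39: «Choosing some fixed ordering, define an
n-linear mapping from K₁F × ⋯ × K₁F to the integers modulo 2 by the correspondence l(a₁) × ⋯ × l(aₙ) ↦
(1 − sgn(a₁))/2 ⋯ (1 − sgn(aₙ))/2. […] Hence this correspondence induces a homomorphism K_nF → ℤ/2ℤ; which carries
l(−1)ⁿ to 1.»)

## What is formalised

* §1 for any ordered field `F` (`[LinearOrder F] [IsStrictOrderedRing F]`): the positive cone `nonnegPreordering F`
  (total), the sign homomorphism **`signHomOrd F n : K_nF →+ ℤ/2ℤ`** (g40-#4's `signHomK` for this cone),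
  `signHomOrd_symbol_neg_one`, `signHomOrd_symbol_eq_zero_of_pos`, `signHomOrd_two_zsmul`, **«l(−1)ⁿ is not divisible»
  `symbol_neg_one_ne_two_zsmul`**, and **`addOrderOf_symbol_neg_one : addOrderOf l(−1)ⁿ = 2`** (`n ≥ 1`; with the
  field-general `two_zsmul_symbol_neg_one`, `symbol_update_neg_one_update_mul_self`).
* §2 for `F = ℝ`: `absUnit`, square and `k`-th roots of positive reals (`exists_mul_self_of_pos`, `exists_pow_of_pos`,
  via `Real.sqrt` / `Real.rpow`), **`symbol_eq_zero_of_neg_one_of_pos`** (`{…, −1, …, x, …} = 0` for `x > 0`), the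
  generators `posSymbols` and **`posPart n = D`**, the decomposition **`symbol_eq_symbol_abs_add`**
  (`{a} = {|a|} + [all aᵢ < 0]·l(−1)ⁿ`, «easily proved by induction on n»), and the splitting:
  **`zmultiples_sup_posPart_eq_top`** (`ℤ·l(−1)ⁿ + D = K_nℝ`), **`zmultiples_inf_posPart_eq_bot`** (`ℤ·l(−1)ⁿ ∩ D = 0`),
  **`posPart_divisible`** («a divisible group»), all for `n ≥ 1`.

## References

* [Milnor1970] J. Milnor, *Algebraic K-theory and quadratic forms*, Invent. Math. 9 (1970) 318–344 — §1 Example 1.6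
  (p0004 L13–L17), proof of Theorem 1.4 (p0003 L25–L39).

Provenance: lane `lit-hodgefound`, seat `lit-hodgefound-p27` gen 40 (agent `literature-prover-lit-hodgefound-p27-g40-0`),
row g40-#5.
-/

set_option autoImplicit false

noncomputable section

namespace Literature.RingTheory.KTheory

/-! ### §1 ordered fields: the positive cone and the sign homomorphism -/

section OrderedField

variable (F : Type*) [Field F] [LinearOrder F] [IsStrictOrderedRing F]

/-- The non-negative elements of an ordered field as a (total) preordering — «Choosing some fixed ordering». [cite: Milnor1970, §1 proof of Theorem 1.4 (p0003 L25–L39); Example 1.6 «using the argument of §1.4» (p0004 L16–L17)] -/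
def nonnegPreordering : RingPreordering F :=
  RingPreordering.mk' {x : F | 0 ≤ x} (fun {x y} hx hy => add_nonneg hx hy) (fun {x y} hx hy => mul_nonneg hx hy)
    (fun x => mul_self_nonneg x) (by simp)

variable {F}

/-- Membership in the positive cone. [cite: Milnor1970, §1 proof of Theorem 1.4 (p0003 L25–L39); Example 1.6 «using the argument of §1.4» (p0004 L16–L17)] -/
theorem mem_nonnegPreordering_iff (x : F) : x ∈ nonnegPreordering F ↔ 0 ≤ x := Iff.rfl

/-- The positive cone of an ordered field is total. [cite: Milnor1970, §1 proof of Theorem 1.4 (p0003 L25–L39); Example 1.6 «using the argument of §1.4» (p0004 L16–L17)] -/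
theorem nonnegPreordering_total (a : F) : a ∈ nonnegPreordering F ∨ -a ∈ nonnegPreordering F := by
  rw [mem_nonnegPreordering_iff, mem_nonnegPreordering_iff, neg_nonneg]; exact le_total 0 a

/-- `(1 − sgn a)/2 = 0` for `a > 0`. [cite: Milnor1970, §1 proof of Theorem 1.4 (p0003 L25–L39); Example 1.6 «using the argument of §1.4» (p0004 L16–L17)] -/
theorem sgnBit_nonneg_of_pos {a : Fˣ} (ha : 0 < (a : F)) : sgnBit (nonnegPreordering F) a = 0 :=
  sgnBit_of_mem ha.le

/-- `(1 − sgn a)/2 = 1` for `a < 0`. [cite: Milnor1970, §1 proof of Theorem 1.4 (p0003 L25–L39); Example 1.6 «using the argument of §1.4» (p0004 L16–L17)] -/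
theorem sgnBit_nonneg_of_neg {a : Fˣ} (ha : (a : F) < 0) : sgnBit (nonnegPreordering F) a = 1 :=
  sgnBit_of_not_mem (by rw [mem_nonnegPreordering_iff, not_le]; exact ha)

end OrderedField

namespace MilnorK

open Function

section AnyField

variable {K : Type*} [Field K]

/-- `2·l(−1)ⁿ = 0` for `n ≥ 1` («Since 2l(−1) = 0»): the cyclic group generated by `l(−1)ⁿ` has order `≤ 2`. [cite: Milnor1970, §1 proof of Theorem 1.4 (p0003 L45), Example 1.6 (p0004 L14–L15)] -/
theorem two_zsmul_symbol_neg_one (m : ℕ) : (2 : ℤ) • symbol (fun _ : Fin (m + 1) => (-1 : Kˣ)) = 0 := by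
  have h : (fun _ : Fin (m + 1) => (-1 : Kˣ)) = Fin.cons (-1) (fun _ : Fin m => (-1 : Kˣ)) := by
    funext j; refine Fin.cases rfl (fun k => rfl) j
  rw [h, ← cons_symbol, two_smul_cons_neg_one]

/-- `{…, −1, …, y², …} = {…, (−1)², …, y, …} = 0`: a symbol with an entry `−1` and a square entry vanishes. [cite: Milnor1970, §1 Example 1.6 (p0004 L13–L17)] -/
theorem symbol_update_neg_one_update_mul_self {m : ℕ} (a : Fin m → Kˣ) {i j : Fin m} (hij : i ≠ j)
    (y : Kˣ) : symbol (update (update a i (-1)) j (y * y)) = 0 := by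
  rw [symbol_update_mul, ← two_zsmul, update_comm hij, ← symbol_update_zpow,
    show ((-1 : Kˣ) ^ (2 : ℤ)) = 1 by rw [zpow_two, neg_one_mul, neg_neg], symbol_update_one]

end AnyField

section OrderedField

variable {F : Type*} [Field F] [LinearOrder F] [IsStrictOrderedRing F] {n : ℕ}

variable (F n) in
/-- **The homomorphism `K_nF → ℤ/2ℤ` of an ordered field**, `{a₁, …, aₙ} ↦ ∏ (1 − sgn aᵢ)/2` («the argument of §1.4»). [cite: Milnor1970, §1 proof of Theorem 1.4 (p0003 L25–L39); Example 1.6 «using the argument of §1.4» (p0004 L16–L17)] -/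
def signHomOrd : MilnorK F n →+ ZMod 2 := signHomK n (nonnegPreordering F) nonnegPreordering_total

/-- Its value on a symbol. [cite: Milnor1970, §1 proof of Theorem 1.4 (p0003 L25–L39); Example 1.6 «using the argument of §1.4» (p0004 L16–L17)] -/
theorem signHomOrd_symbol (a : Fin n → Fˣ) : signHomOrd F n (symbol a) = ∏ j, sgnBit (nonnegPreordering F) (a j) :=
  signHomK_symbol _ _ a

/-- «carries l(−1)ⁿ to 1». [cite: Milnor1970, §1 proof of Theorem 1.4 (p0003 L25–L39); Example 1.6 «using the argument of §1.4» (p0004 L16–L17)] -/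
theorem signHomOrd_symbol_neg_one : signHomOrd F n (symbol fun _ : Fin n => (-1 : Fˣ)) = 1 :=
  signHomK_symbol_neg_one _ _

/-- A symbol with a positive entry is killed. [cite: Milnor1970, §1 proof of Theorem 1.4 (p0003 L25–L39); Example 1.6 «using the argument of §1.4» (p0004 L16–L17)] -/
theorem signHomOrd_symbol_eq_zero_of_pos (a : Fin n → Fˣ) {j : Fin n} (hj : 0 < (a j : F)) : signHomOrd F n (symbol a) = 0 := by
  rw [signHomOrd_symbol]
  exact Finset.prod_eq_zero (Finset.mem_univ j) (sgnBit_nonneg_of_pos hj)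

/-- `2K_nF` is killed. [cite: Milnor1970, §1 proof of Theorem 1.4 (p0003 L25–L39); Example 1.6 «using the argument of §1.4» (p0004 L16–L17)] -/
theorem signHomOrd_two_zsmul (z : MilnorK F n) : signHomOrd F n ((2 : ℤ) • z) = 0 := by
  rw [map_zsmul]
  generalize signHomOrd F n z = t
  revert t; decide

/-- **«using the argument of §1.4 to show that l(−1)ⁿ is not divisible»**: `l(−1)ⁿ ∉ 2K_nF`. [cite: Milnor1970, §1 Example 1.6 (p0004 L13–L17)] -/
theorem symbol_neg_one_ne_two_zsmul (z : MilnorK F n) : symbol (fun _ : Fin n => (-1 : Fˣ)) ≠ (2 : ℤ) • z := by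
  intro h
  have := signHomOrd_symbol_neg_one (F := F) (n := n)
  rw [h, signHomOrd_two_zsmul] at this
  exact zero_ne_one this

/-- `l(−1)ⁿ ≠ 0` over an ordered field. [cite: Milnor1970, §1 proof of Theorem 1.4 (p0003 L25–L39); Example 1.6 «using the argument of §1.4» (p0004 L16–L17)] -/
theorem symbol_neg_one_ne_zero_ord : symbol (fun _ : Fin n => (-1 : Fˣ)) ≠ 0 := by
  intro h
  exact symbol_neg_one_ne_two_zsmul (F := F) (n := n) 0 (by rw [zsmul_zero]; exact h)

/-- **«a cyclic group of order 2 generated by l(−1)ⁿ»**: `l(−1)ⁿ` has additive order `2` for `n ≥ 1`. [cite: Milnor1970, §1 Example 1.6 (p0004 L13–L17)] -/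
theorem addOrderOf_symbol_neg_one (m : ℕ) : addOrderOf (symbol (fun _ : Fin (m + 1) => (-1 : Fˣ))) = 2 := by
  rw [addOrderOf_eq_prime_iff]
  refine ⟨?_, symbol_neg_one_ne_zero_ord⟩
  rw [← natCast_zsmul]
  exact two_zsmul_symbol_neg_one m

end OrderedField

/-! ### §2 `K_nℝ` -/

section Real

variable {n : ℕ}

/-- `|a|` as a unit of `ℝ`. [cite: Milnor1970, §1 Example 1.6 (p0004 L13–L17)] -/
def absUnit (a : ℝˣ) : ℝˣ := Units.mk0 |(a : ℝ)| (abs_ne_zero.2 a.ne_zero)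

/-- The value of `absUnit`. [cite: Milnor1970, §1 Example 1.6 (p0004 L13–L17)] -/
@[simp] theorem coe_absUnit (a : ℝˣ) : (absUnit a : ℝ) = |(a : ℝ)| := rfl

/-- `|a| > 0`. [cite: Milnor1970, §1 Example 1.6 (p0004 L13–L17)] -/
theorem absUnit_pos (a : ℝˣ) : 0 < (absUnit a : ℝ) := abs_pos.2 a.ne_zero

/-- `a = |a|` for `a > 0`. [cite: Milnor1970, §1 Example 1.6 (p0004 L13–L17)] -/
theorem eq_absUnit_of_pos {a : ℝˣ} (ha : 0 < (a : ℝ)) : a = absUnit a := Units.ext (by rw [coe_absUnit, abs_of_pos ha])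

/-- `a = (−1)·|a|` for `a < 0`. [cite: Milnor1970, §1 Example 1.6 (p0004 L13–L17)] -/
theorem eq_neg_one_mul_absUnit_of_neg {a : ℝˣ} (ha : (a : ℝ) < 0) : a = -1 * absUnit a :=
  Units.ext (by rw [Units.val_mul, Units.val_neg, Units.val_one, coe_absUnit, abs_of_neg ha, neg_one_mul, neg_neg])

/-- A positive real is a square of a positive real. [cite: Milnor1970, §1 Example 1.6 (p0004 L13–L17)] -/
theorem exists_mul_self_of_pos {x : ℝˣ} (hx : 0 < (x : ℝ)) : ∃ y : ℝˣ, 0 < (y : ℝ) ∧ x = y * y := by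
  have hs : 0 < Real.sqrt x := Real.sqrt_pos.2 hx
  refine ⟨Units.mk0 (Real.sqrt x) hs.ne', hs, Units.ext ?_⟩
  rw [Units.val_mul, Units.val_mk0, Real.mul_self_sqrt hx.le]

/-- A positive real is a `k`-th power of a positive real (`k ≥ 1`). [cite: Milnor1970, §1 Example 1.6 (p0004 L13–L17)] -/
theorem exists_pow_of_pos {x : ℝˣ} (hx : 0 < (x : ℝ)) {m : ℕ} (hm : m ≠ 0) : ∃ y : ℝˣ, 0 < (y : ℝ) ∧ x = y ^ m := by
  have hy : 0 < (x : ℝ) ^ ((m : ℝ)⁻¹) := Real.rpow_pos_of_pos hx _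
  refine ⟨Units.mk0 _ hy.ne', hy, Units.ext ?_⟩
  rw [Units.val_pow_eq_pow_val, Units.val_mk0, Real.rpow_inv_natCast_pow hx.le hm]

/-- **`{…, −1, …, x, …} = 0` for `x > 0`** (`x = y²`, so the symbol is `{…, (−1)², …, y, …}`). [cite: Milnor1970, §1 Example 1.6 (p0004 L13–L17)] -/
theorem symbol_eq_zero_of_neg_one_of_pos (a : Fin n → ℝˣ) {i j : Fin n} (hij : i ≠ j) (hi : a i = -1) (hj : 0 < (a j : ℝ)) :
    symbol a = 0 := by
  obtain ⟨y, -, hy⟩ := exists_mul_self_of_pos hj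
  have ha : a = update (update a i (-1)) j (y * y) := by
    rw [← hy, ← hi, update_eq_self, update_eq_self]
  rw [ha]
  exact symbol_update_neg_one_update_mul_self a hij y

variable (n) in
/-- The symbols `{x₁, …, xₙ}` with all `xᵢ > 0` («all products l(a₁)⋯l(aₙ) with a₁, …, aₙ > 0»). [cite: Milnor1970, §1 Example 1.6 (p0004 L13–L17)] -/
def posSymbols : Set (MilnorK ℝ n) := {z | ∃ x : Fin n → ℝˣ, (∀ j, 0 < (x j : ℝ)) ∧ z = symbol x}

variable (n) in
/-- **The subgroup generated by the `{x₁, …, xₙ}` with all `xᵢ > 0`** («a divisible group generated by all products l(a₁)⋯l(aₙ) with a₁, …, aₙ > 0»). [cite: Milnor1970, §1 Example 1.6 (p0004 L13–L17)] -/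
def posPart : AddSubgroup (MilnorK ℝ n) := AddSubgroup.closure (posSymbols n)

/-- The generators lie in `posPart`. [cite: Milnor1970, §1 Example 1.6 (p0004 L13–L17)] -/
theorem symbol_mem_posPart (x : Fin n → ℝˣ) (hx : ∀ j, 0 < (x j : ℝ)) : symbol x ∈ posPart n :=
  AddSubgroup.subset_closure ⟨x, hx, rfl⟩

open Classical in
/-- **The decomposition of a symbol of positive degree: `{a₁, …, aₙ} = {|a₁|, …, |aₙ|} + [all aᵢ < 0]·{−1, …, −1}`** (write `aᵢ = ±|aᵢ|` and expand; the mixed terms contain `−1` and a positive entry and vanish; «easily proved by induction on n»). [cite: Milnor1970, §1 Example 1.6 (p0004 L13–L17)] -/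
theorem symbol_eq_symbol_abs_add (m : ℕ) (a : Fin (m + 1) → ℝˣ) :
    symbol a = symbol (fun j => absUnit (a j)) +
      (if ∀ j, (a j : ℝ) < 0 then symbol (fun _ : Fin (m + 1) => (-1 : ℝˣ)) else 0) := by
  induction m with
  | zero =>
    by_cases h0 : (a 0 : ℝ) < 0
    · have hall : ∀ j, (a j : ℝ) < 0 := fun j => by rw [Fin.eq_zero j]; exact h0
      rw [if_pos hall]
      have ha : a = update a 0 (-1 * absUnit (a 0)) := by
        rw [← eq_neg_one_mul_absUnit_of_neg h0, update_eq_self]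
      have e1 : (fun j : Fin 1 => absUnit (a j)) = update a 0 (absUnit (a 0)) := by
        funext j; rw [Fin.eq_zero j, update_self]
      have e2 : (fun _ : Fin 1 => (-1 : ℝˣ)) = update a 0 (-1) := by
        funext j; rw [Fin.eq_zero j, update_self]
      rw [e1, e2]
      conv_lhs => rw [ha]
      rw [symbol_update_mul, add_comm (symbol (update a 0 (-1 : ℝˣ)))]
    · have hpos : 0 < (a 0 : ℝ) := lt_of_le_of_ne (not_lt.1 h0) (Ne.symm (a 0).ne_zero)
      rw [if_neg (fun h => h0 (h 0)), add_zero]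
      congr 1; funext j; rw [Fin.eq_zero j]; exact eq_absUnit_of_pos hpos
  | succ m ih =>
    have htail := ih (Fin.tail a)
    have hneg1 : (fun _ : Fin (m + 2) => (-1 : ℝˣ)) = Fin.cons (-1) (fun _ : Fin (m + 1) => (-1 : ℝˣ)) := by
      funext j; refine Fin.cases rfl (fun k => rfl) j
    have habs : (fun j : Fin (m + 2) => absUnit (a j)) = Fin.cons (absUnit (a 0)) (fun j => absUnit (Fin.tail a j)) := by
      funext j; refine Fin.cases rfl (fun k => rfl) j
    have z1 : symbol (Fin.cons (-1) (fun j => absUnit (Fin.tail a j)) : Fin (m + 2) → ℝˣ) = 0 :=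
      symbol_eq_zero_of_neg_one_of_pos _ (i := 0) (j := Fin.succ 0) (Fin.succ_ne_zero 0).symm (Fin.cons_zero _ _)
        (by rw [Fin.cons_succ]; exact absUnit_pos _)
    have z2 : symbol (Fin.cons (absUnit (a 0)) (fun _ : Fin (m + 1) => (-1 : ℝˣ)) : Fin (m + 2) → ℝˣ) = 0 :=
      symbol_eq_zero_of_neg_one_of_pos _ (i := Fin.succ 0) (j := 0) (Fin.succ_ne_zero 0) (Fin.cons_succ _ _ _)
        (by rw [Fin.cons_zero]; exact absUnit_pos _)
    rw [← Fin.cons_self_tail a, ← cons_symbol, htail, map_add, Fin.cons_self_tail]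
    by_cases h0 : (a 0 : ℝ) < 0
    · have hsplit : cons (a 0) = cons (n := m + 1) (-1 : ℝˣ) + cons (absUnit (a 0)) := by
        conv_lhs => rw [eq_neg_one_mul_absUnit_of_neg h0]
        exact AddMonoidHom.ext fun z => cons_mul _ _ z
      by_cases hall' : ∀ j, (Fin.tail a j : ℝ) < 0
      · have hall : ∀ j : Fin (m + 2), (a j : ℝ) < 0 := fun j => Fin.cases h0 (fun k => hall' k) j
        rw [if_pos hall', if_pos hall, hsplit, AddMonoidHom.add_apply, AddMonoidHom.add_apply, cons_symbol, cons_symbol,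
          cons_symbol, cons_symbol, z1, zero_add, ← habs, ← hneg1, z2, add_zero]
      · have hall : ¬ ∀ j : Fin (m + 2), (a j : ℝ) < 0 := fun h => hall' fun k => h k.succ
        rw [if_neg hall', if_neg hall, map_zero, add_zero, add_zero, hsplit, AddMonoidHom.add_apply, cons_symbol, cons_symbol,
          z1, zero_add, ← habs]
    · have hpos : 0 < (a 0 : ℝ) := lt_of_le_of_ne (not_lt.1 h0) (Ne.symm (a 0).ne_zero)
      have hall : ¬ ∀ j : Fin (m + 2), (a j : ℝ) < 0 := fun h => h0 (h 0)
      have ha0 : a 0 = absUnit (a 0) := eq_absUnit_of_pos hpos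
      rw [if_neg hall, add_zero, ha0, cons_symbol, ← habs]
      conv_rhs => rw [← add_zero (symbol _)]
      congr 1
      by_cases hall' : ∀ j, (Fin.tail a j : ℝ) < 0
      · rw [if_pos hall', cons_symbol, z2]
      · rw [if_neg hall', map_zero]

/-- **`K_nℝ = ℤ·l(−1)ⁿ + D`** for `n ≥ 1`. [cite: Milnor1970, §1 Example 1.6 (p0004 L13–L17)] -/
theorem zmultiples_sup_posPart_eq_top (m : ℕ) :
    AddSubgroup.zmultiples (symbol (fun _ : Fin (m + 1) => (-1 : ℝˣ))) ⊔ posPart (m + 1) = ⊤ := by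
  classical
  rw [eq_top_iff]
  rintro z -
  induction z using induction_on with
  | hsym k a =>
    refine AddSubgroup.zsmul_mem _ ?_ k
    rw [symbol_eq_symbol_abs_add m a]
    refine AddSubgroup.add_mem _ (AddSubgroup.mem_sup_right (symbol_mem_posPart _ fun j => absUnit_pos _))
      (AddSubgroup.mem_sup_left ?_)
    split_ifs
    · exact AddSubgroup.mem_zmultiples _
    · exact AddSubgroup.zero_mem _
  | hadd x y hx hy => exact AddSubgroup.add_mem _ hx hy

/-- The sign homomorphism kills `D` (positive degree). [cite: Milnor1970, §1 proof of Theorem 1.4 (p0003 L25–L39); Example 1.6 «using the argument of §1.4» (p0004 L16–L17)] -/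
theorem signHomOrd_eq_zero_of_mem_posPart (m : ℕ) {z : MilnorK ℝ (m + 1)} (hz : z ∈ posPart (m + 1)) :
    signHomOrd ℝ (m + 1) z = 0 := by
  have hle : posPart (m + 1) ≤ (signHomOrd ℝ (m + 1)).ker := by
    rw [posPart, AddSubgroup.closure_le]
    rintro z ⟨x, hx, rfl⟩
    rw [SetLike.mem_coe, AddMonoidHom.mem_ker]
    exact signHomOrd_symbol_eq_zero_of_pos x (hx 0)
  exact (AddMonoidHom.mem_ker).1 (hle hz)

/-- **The sum is direct: `ℤ·l(−1)ⁿ ∩ D = 0`** (`n ≥ 1`; an element `k·l(−1)ⁿ` of `D` has sign `k mod 2 = 0`, and `2·l(−1)ⁿ = 0`). [cite: Milnor1970, §1 Example 1.6 (p0004 L13–L17)] -/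
theorem zmultiples_inf_posPart_eq_bot (m : ℕ) :
    AddSubgroup.zmultiples (symbol (fun _ : Fin (m + 1) => (-1 : ℝˣ))) ⊓ posPart (m + 1) = ⊥ := by
  rw [eq_bot_iff]
  rintro z ⟨hz1, hz2⟩
  rw [AddSubgroup.mem_bot]
  obtain ⟨k, rfl⟩ := AddSubgroup.mem_zmultiples_iff.1 hz1
  have hsign := signHomOrd_eq_zero_of_mem_posPart m hz2
  rw [map_zsmul, signHomOrd_symbol_neg_one, zsmul_eq_mul, _root_.mul_one] at hsign
  -- `k` is even
  obtain ⟨j, rfl⟩ : (2 : ℤ) ∣ k := (ZMod.intCast_zmod_eq_zero_iff_dvd k 2).1 hsign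
  rw [mul_comm, mul_zsmul, two_zsmul_symbol_neg_one, zsmul_zero]

/-- **`D` is divisible** (positive degree): every element of `D` is a `k`-th multiple in `D` for every `k ≥ 1` (`{x₁, x₂, …} = k·{x₁^{1/k}, x₂, …}`). [cite: Milnor1970, §1 Example 1.6 (p0004 L13–L17)] -/
theorem posPart_divisible (m : ℕ) {z : MilnorK ℝ (m + 1)} (hz : z ∈ posPart (m + 1)) {k : ℕ} (hk : k ≠ 0) :
    ∃ w ∈ posPart (m + 1), (k : ℤ) • w = z := by
  induction hz using AddSubgroup.closure_induction with
  | mem z hz =>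
    obtain ⟨x, hx, rfl⟩ := hz
    obtain ⟨y, hy, hxy⟩ := exists_pow_of_pos (hx 0) hk
    refine ⟨symbol (update x 0 y), symbol_mem_posPart _ fun j => ?_, ?_⟩
    · by_cases hj : j = 0
      · subst hj; rw [update_self]; exact hy
      · rw [update_of_ne hj]; exact hx j
    · rw [← symbol_update_zpow, zpow_natCast, ← hxy, update_eq_self]
  | zero => exact ⟨0, AddSubgroup.zero_mem _, zsmul_zero _⟩
  | add x y _ _ hx hy =>
    obtain ⟨a, ha, rfl⟩ := hx
    obtain ⟨b, hb, rfl⟩ := hy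
    exact ⟨a + b, AddSubgroup.add_mem _ ha hb, zsmul_add _ _ _⟩
  | neg x _ hx =>
    obtain ⟨a, ha, rfl⟩ := hx
    exact ⟨-a, AddSubgroup.neg_mem _ ha, zsmul_neg _ _⟩

end Real

end MilnorK

end Literature.RingTheory.KTheory

end
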